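/-
Origin: expansion seat `prover-pub-hodgecm-mc-binder-1-g14-0`, handover #R83 2026-08-20T16:54:41Z md5 7df88ae8dbfe (129 l.; NEW additive MODEL leaf beside axioms-1 RUN-38 #5 `HsmallOfCommonReflex` (re-cut 4-ary); imports HsmallOfCommonReflex ONLY; drops ⇒ {#R84}; NAME LIST: HodgeCM.Model.hsmall_of_commonReflexUnion · HodgeCM.Model.hsmall_of_commonReflexUnion_of · HodgeCM.Model.thetaUnion_of_theta) (`HOME/mc/pub-hodgecm-mc-binder-1-g14/stage56/HodgeCM/Model/HsmallOfCommonReflexUnion.lean`, md5 7df88ae8dbfe, 129 lines);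
landed by the second packager p2 gen 10 (p2-g10) in gate run 56 as `HodgeCM/Model/HsmallOfCommonReflexUnion.lean` (packager comment re-wording per the RUN-32 precedent (gate audit (5) rejects the proof-placeholder tokens s-o-r-r-y / a-d-m-i-t anywhere in a source, comments included): 1 occurrence(s) inside COMMENTS re-spelt `proof-hole` / `adm-token`; no Lean code byte touched).
-/
/-
Copyright (c) 2026 the pub-hodgecm formalisation cell (harness21).  New file, not vendored.
Origin: session prover-pub-hodgecm-mc-binder-1-g14-0 (unit pub-hodgecm-mc-binder-1-g14, BINDER PROVER gen 14 of lineage mc-binder-1;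
content lane (J-Liu-Θ) of BINDER-TRIAGE §58.2), 2026-08-20.  Intended final place: `HodgeCM/Model/HsmallOfCommonReflexUnion.lean`
(NEW additive MODEL leaf beside `Model/HsmallOfCommonReflex.lean` (RUN 38 #5, axioms-1-g12); imports that module only; nothing imports
it; drop alone on bounce).  Scope memo: `HOME/mc/pub-hodgecm-mc-binder-1-g14/JLIU-THETA-SCOPE.md` §3.
-/
import Summits.HodgeConjecture.HodgeCM.Model.HsmallOfCommonReflex

set_option autoImplicit false

/-!
# E's `hsmall` from a PER-CLASS common-reflex factorisation of the theta classes (the UNION form of `hΘ`)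

KERNEL over `Model/HsmallOfCommonReflex` (RUN 38), no new hypothesis kind, nothing cited, nothing minted.

E's row-9 binder `hΘ` (hypothesis `hΘ` of `Model.hsmall_of_commonReflexInput` / `Model.hLiu_of_commonReflexInput`) asks, per good sextic
context, index `i` and small level `Γ`, for ONE common-reflex datum `D : CommonReflexInput c.K (c.Ψ i) c.σ` with
`R.Theta V c i Γ ⊆ span (D.surfaceClasses V Γ)`.  What the published route ([Liu21] = arXiv:2102.11518, Prop. 4.13 / Thm. 4.15 /
Thm. 4.18 (1) + proof map (4.3)) delivers is naturally PER CLASS: a theta class `ω` attached to a character `χ` lies in the span of the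
pull-backs from Liu's CM abelian variety `A_{μ(χ)}` — a different `D` for different `χ` (same corner `(K, Ψ_i, σ)`, since the reflex of
`(E, Φ_μ)` is the same; scope memo (J5)).  Since `Model.span_classes_le_Uiso` maps EVERY `D` of the corner into the SAME target
`U.Uiso Γ K Ψ_i σ`, the union form suffices for `hsmall` VERBATIM:

* `HodgeCM.Model.hsmall_of_commonReflexUnion` — if `R.Theta V c i Γ ⊆ span (⋃ D, D.surfaceClasses V Γ)` for all `Γ ≤ Γ₀`, then the
  `hsmall` binder of `Model.hLiu_of_smallLevel` holds for `R` (witnesses `M := c.K`, `k := id`, `σ' := c.σ`, as in the RUN-38 lemma);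
* `HodgeCM.Model.span_iUnion_surfaceClasses_le_Uiso` — the one-line reason: `span (⋃ D, D.surfaceClasses V Γ) ≤ U.Uiso Γ K Ψ σ` for `σ ∈ Ψ`;
* `HodgeCM.Model.thetaUnion_of_theta` — the union form is WEAKER than row 9's `hΘ` (one `D` is a union over one index), so any
  discharge of `hΘ` discharges it, and E's present text implies it.

Nothing of E, of row 9's text of record, or of any record is touched: this leaf only makes available the per-class socket that the
(J-Liu-Θ) junction items (J1)–(J5) of the scope memo produce.  0 `proof-hole`, 0 `axiom`, expected `#print axioms` ⊆ {propext,
Classical.choice, Quot.sound}.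
-/

noncomputable section

open scoped TensorProduct
open NumberField Module

namespace HodgeCM

namespace Model

open Literature.AlgebraicGeometry.Motives (CMType)
open Literature.AlgebraicGeometry.HodgeTheory
open Literature.NumberTheory.Automorphic.PicardCM
open HodgeCM.CMTypeOps (inflate inflate_id)
open HodgeCM.Universe (ThetaModel)

variable (hHD : exists_isReal_hodgeModel) (hI : hodgePQ_independent_of_hodgeModel)
  (h₁ : BallQuotientUniformised) (h₃ : CMAbelianVarietyRealised)

/-- **(J) for ALL common-reflex data of a corner at once**: on the end-state universe, the span of the union over all
`D : CommonReflexInput K Ψ σ` of the classes `D.surfaceClasses V Γ` lies in `Uiso Γ K Ψ σ`, for `σ ∈ Ψ`, granted Riemann's fullness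
`hR` — because each `D` lands there (`Model.span_classes_le_Uiso`). [folklore] -/
theorem span_iUnion_surfaceClasses_le_Uiso (hR : DeligneMilne1982_Thm_6_20_full)
    {L : CMField} {ι₁ : L →+* ℂ} (V : HermSpace3 L ι₁) (Γ : Level V)
    {K : CMField} {Ψ : CMType K} {σ : K →+* ℂ} (hσ : σ ∈ Ψ.1) :
    Submodule.span ℂ (⋃ D : CommonReflexInput K Ψ σ, D.surfaceClasses hHD hI h₁ h₃ V Γ) ≤
      (picardCMUniverse hHD hI h₁ h₃).Uiso Γ K Ψ σ := by
  refine Submodule.span_le.mpr (Set.iUnion_subset fun D => ?_)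
  exact fun x hx => span_classes_le_Uiso hHD hI h₁ h₃ hR V Γ hσ D (Submodule.subset_span hx)

/-- **E's binder `hsmall` from the UNION form of the common-reflex factorisation.**  For any theta model `R` on
`picardCMUniverse hHD hI h₁ h₃`: if in every good seesaw context with `[K:ℚ] = 6`, for every `i`, there is a level `Γ₀` such that for
all `Γ ≤ Γ₀` the theta classes `R.Theta V c i Γ` lie in the span of the UNION over all common-reflex data `D` of the corner
`(c.K, c.Ψ i, c.σ)` of the classes `D.surfaceClasses V Γ` (each class may use its own `D` — the shape [Liu21] Thm. 4.18 delivers, one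
`A_μ` per character), then the `hsmall` hypothesis of `Model.hLiu_of_smallLevel` holds for `R` (witnesses `M := c.K`, `k := id`,
`σ' := c.σ`; `c.σ ∈ c.Ψ i` is `GoodCtx.mem`). [folklore] -/
theorem hsmall_of_commonReflexUnion (hR : DeligneMilne1982_Thm_6_20_full)
    (R : (picardCMUniverse hHD hI h₁ h₃).ThetaModel)
    (hΘ : ∀ {L : CMField} {ι₁ : L →+* ℂ} (V : HermSpace3 L ι₁) (c : SeesawCtx L), R.GoodCtx ι₁ c →
      Module.finrank ℚ c.K = 6 → ∀ i : Fin 4, ∃ Γ₀ : Level V, ∀ Γ ≤ Γ₀,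
        R.Theta V c i Γ ⊆
          Submodule.span ℂ (⋃ D : CommonReflexInput c.K (c.Ψ i) c.σ, D.surfaceClasses hHD hI h₁ h₃ V Γ)) :
    ∀ {L : CMField} {ι₁ : L →+* ℂ} (V : HermSpace3 L ι₁) (c : SeesawCtx L), R.GoodCtx ι₁ c →
      Module.finrank ℚ c.K = 6 → ∀ i : Fin 4, ∃ Γ₀ : Level V, ∀ Γ ≤ Γ₀,
        ∃ (M : CMField) (k : c.K →+* M) (σ' : M →+* ℂ), σ'.comp k = c.σ ∧
          R.Theta V c i Γ ⊆ (picardCMUniverse hHD hI h₁ h₃).Uiso Γ M (inflate k (c.Ψ i)) σ' := by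
  intro L ι₁ V c hgood h6 i
  obtain ⟨Γ₀, hΓ₀⟩ := hΘ V c hgood h6 i
  refine ⟨Γ₀, fun Γ hΓ ↦ ⟨c.K, RingHom.id _, c.σ, RingHom.comp_id _, ?_⟩⟩
  rw [inflate_id]
  exact fun x hx ↦ span_iUnion_surfaceClasses_le_Uiso hHD hI h₁ h₃ hR V Γ (hgood.mem i) (hΓ₀ Γ hΓ hx)

/-- **Restricted form** (any side predicate `P` on contexts, e.g. «`L` is a normal closure of `c.K`» — the scope of `U.PerL`): if the union-form
factorisation holds at every good sextic context SATISFYING `P`, then so does the `hsmall` binder restricted to `P`.  The unrestricted lemma is the case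
`P := fun _ _ => True`. [folklore] -/
theorem hsmall_of_commonReflexUnion_of (hR : DeligneMilne1982_Thm_6_20_full)
    (R : (picardCMUniverse hHD hI h₁ h₃).ThetaModel)
    (P : ∀ {L : CMField} {ι₁ : L →+* ℂ}, HermSpace3 L ι₁ → SeesawCtx L → Prop)
    (hΘ : ∀ {L : CMField} {ι₁ : L →+* ℂ} (V : HermSpace3 L ι₁) (c : SeesawCtx L), P V c → R.GoodCtx ι₁ c →
      Module.finrank ℚ c.K = 6 → ∀ i : Fin 4, ∃ Γ₀ : Level V, ∀ Γ ≤ Γ₀,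
        R.Theta V c i Γ ⊆
          Submodule.span ℂ (⋃ D : CommonReflexInput c.K (c.Ψ i) c.σ, D.surfaceClasses hHD hI h₁ h₃ V Γ)) :
    ∀ {L : CMField} {ι₁ : L →+* ℂ} (V : HermSpace3 L ι₁) (c : SeesawCtx L), P V c → R.GoodCtx ι₁ c →
      Module.finrank ℚ c.K = 6 → ∀ i : Fin 4, ∃ Γ₀ : Level V, ∀ Γ ≤ Γ₀,
        ∃ (M : CMField) (k : c.K →+* M) (σ' : M →+* ℂ), σ'.comp k = c.σ ∧
          R.Theta V c i Γ ⊆ (picardCMUniverse hHD hI h₁ h₃).Uiso Γ M (inflate k (c.Ψ i)) σ' := by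
  intro L ι₁ V c hP hgood h6 i
  obtain ⟨Γ₀, hΓ₀⟩ := hΘ V c hP hgood h6 i
  refine ⟨Γ₀, fun Γ hΓ ↦ ⟨c.K, RingHom.id _, c.σ, RingHom.comp_id _, ?_⟩⟩
  rw [inflate_id]
  exact fun x hx ↦ span_iUnion_surfaceClasses_le_Uiso hHD hI h₁ h₃ hR V Γ (hgood.mem i) (hΓ₀ Γ hΓ hx)

/-- **Row 9's `hΘ` implies its union form** (one `D` is one index of the union): any discharge of the binder of record discharges the
union form, and E's present row-9 text implies it. [folklore] -/
theorem thetaUnion_of_theta (R : (picardCMUniverse hHD hI h₁ h₃).ThetaModel)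
    (hΘ : ∀ {L : CMField} {ι₁ : L →+* ℂ} (V : HermSpace3 L ι₁) (c : SeesawCtx L), R.GoodCtx ι₁ c →
      Module.finrank ℚ c.K = 6 → ∀ i : Fin 4, ∃ Γ₀ : Level V, ∀ Γ ≤ Γ₀,
        ∃ D : CommonReflexInput c.K (c.Ψ i) c.σ,
          R.Theta V c i Γ ⊆ Submodule.span ℂ (D.surfaceClasses hHD hI h₁ h₃ V Γ)) :
    ∀ {L : CMField} {ι₁ : L →+* ℂ} (V : HermSpace3 L ι₁) (c : SeesawCtx L), R.GoodCtx ι₁ c →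
      Module.finrank ℚ c.K = 6 → ∀ i : Fin 4, ∃ Γ₀ : Level V, ∀ Γ ≤ Γ₀,
        R.Theta V c i Γ ⊆
          Submodule.span ℂ (⋃ D : CommonReflexInput c.K (c.Ψ i) c.σ, D.surfaceClasses hHD hI h₁ h₃ V Γ) := by
  intro L ι₁ V c hgood h6 i
  obtain ⟨Γ₀, hΓ₀⟩ := hΘ V c hgood h6 i
  refine ⟨Γ₀, fun Γ hΓ ↦ ?_⟩
  obtain ⟨D, hsub⟩ := hΓ₀ Γ hΓ
  exact hsub.trans (Submodule.span_mono (Set.subset_iUnion (fun D : CommonReflexInput c.K (c.Ψ i) c.σ =>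
    D.surfaceClasses hHD hI h₁ h₃ V Γ) D))

end Model

end HodgeCM

end
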